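import Mathlib
import HarnessLib

/-!
# `RationalShortRootRigidity` — Step 4 helper (m6): null-cone divisibility

Helper lemma INSIDE the paper proof of crux `stmt-QuantumFields-23124` (`F4SubCurvatureDoor.RationalShortRootRigidity`,
LINE g15-A of planner ym-idea-3; prover notes HOME l15/PLANAR-LEMMA-DETAILED.md, Step (4e) «null-cone injectivity»; free-hands
menu II, item (m6), statement typed in HOME l15/Helpers23124.lean as `Helpers.NullConeDivisibility` — proved here DEF-FREE with
that body verbatim):

**Lemma** (`nullConeDivisibility`).  Let `Ỹ ∈ ℝ[u, q₁, q₂, q₃]` (variable `0 = u`, variables `1..3 = q`).  If `Ỹ(−|q|², q) = 0`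
for every real `q ∈ ℝ³`, then `(u + |q|²) ∣ Ỹ`.

Proof.  Read `Ỹ` as a univariate polynomial `F ∈ S[u]` over the coefficient ring `S = ℝ[q]` (`MvPolynomial.finSuccEquiv`);
`u + |q|² = u − (−|q|²)` is monic linear, so `(u + |q|²) ∣ Ỹ ⇔ F(−|q|²) = 0` in `S` (`Polynomial.dvd_iff_isRoot`).  The element
`F(−|q|²) ∈ ℝ[q]` evaluates at a real point `q` to `Ỹ(−|q|², q)` (`MvPolynomial.eval_eq_eval_mv_eval'`), which vanishes by
hypothesis; a real polynomial vanishing on `ℝ³` is zero (`MvPolynomial.funext`).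

Mathlib only; THEOREMS ONLY (no definitions); no named facts; no `sorry`; default heartbeats.  Nothing about the crux 23124, the
route's rung or the Yang–Mills mass gap is proved here.  Free-hands seat `ym-line-frs-p2` g10 (announced on the owner's bus
2026-08-28T19:42Z), `--supports stmt-QuantumFields-23124`.
-/

set_option autoImplicit false

namespace Summit.QuantumFields.YangMills.Theorems.RationalShortRootRigidity

open scoped BigOperators Polynomial

/-- Under `finSuccEquiv` (variable `0` ↦ the polynomial variable, variable `i+1` ↦ the coefficient variable `i`) the
null-cone form `X₀ + Σᵢ X_{i+1}²` becomes the monic linear polynomial `X − C(−Σᵢ Xᵢ²)`. [folklore] -/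
theorem finSuccEquiv_nullConeForm :
    MvPolynomial.finSuccEquiv ℝ 3 (MvPolynomial.X 0 + ∑ i : Fin 3, MvPolynomial.X (Fin.succ i) ^ 2) =
      Polynomial.X - Polynomial.C (-(∑ i : Fin 3, (MvPolynomial.X i : MvPolynomial (Fin 3) ℝ) ^ 2)) := by
  rw [map_add, map_sum, MvPolynomial.finSuccEquiv_X_zero, map_neg, sub_neg_eq_add, map_sum]
  congr 1
  refine Finset.sum_congr rfl fun i _ => ?_
  rw [map_pow, MvPolynomial.finSuccEquiv_X_succ, map_pow]

/-- **Null-cone divisibility** (m6; Step (4e) of the paper proof of 23124): if `Ỹ(u,q)` vanishes whenever `u = −|q|²`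
(`q ∈ ℝ³`), then `u + |q|²` divides `Ỹ`.  The statement is the body of `Helpers.NullConeDivisibility`
(HOME l15/Helpers23124.lean) verbatim. [folklore] -/
theorem nullConeDivisibility :
    ∀ Y : MvPolynomial (Fin 4) ℝ,
      (∀ q : Fin 3 → ℝ, MvPolynomial.eval (Fin.cons (-(∑ i, q i ^ 2)) q) Y = 0) →
      (MvPolynomial.X 0 + ∑ i : Fin 3, MvPolynomial.X (Fin.succ i) ^ 2) ∣ Y := by
  intro Y hY
  -- the coefficient-ring element `−|q|² ∈ ℝ[q]` and the univariate picture `F ∈ ℝ[q][u]` of `Ỹ`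
  set S2 : MvPolynomial (Fin 3) ℝ := ∑ i : Fin 3, (MvPolynomial.X i : MvPolynomial (Fin 3) ℝ) ^ 2 with hS2
  set F : Polynomial (MvPolynomial (Fin 3) ℝ) := MvPolynomial.finSuccEquiv ℝ 3 Y with hF
  have hevalS2 : ∀ q : Fin 3 → ℝ, MvPolynomial.eval q (-S2) = -(∑ i, q i ^ 2) := by
    intro q
    simp only [hS2, map_neg, map_sum, map_pow, MvPolynomial.eval_X]
  -- `F(−|q|²) ∈ ℝ[q]` vanishes at every real point, hence is zero
  have hroot : F.eval (-S2) = 0 := by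
    apply MvPolynomial.funext
    intro q
    rw [map_zero, ← Polynomial.eval₂_at_apply (MvPolynomial.eval q) (-S2), ← Polynomial.eval_map, hevalS2 q,
      hF, ← MvPolynomial.eval_eq_eval_mv_eval' q (-(∑ i, q i ^ 2)) Y]
    exact hY q
  have hdvd : Polynomial.X - Polynomial.C (-S2) ∣ F := Polynomial.dvd_iff_isRoot.2 hroot
  -- transport back through the algebra isomorphism `finSuccEquiv`
  rw [← map_dvd_iff (MvPolynomial.finSuccEquiv ℝ 3), finSuccEquiv_nullConeForm]
  exact hdvd

end Summit.QuantumFields.YangMills.Theorems.RationalShortRootRigidity
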